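import Summits.ValiantsHypothesis.ValiantsHypothesis.Theses.DepthWindow
import Summits.ValiantsHypothesis.ValiantsHypothesis.Theorems.DepthWindowHomStacks
import HarnessLib

/-!
# The crux `HomSubReach` from a single block lemma (route `DepthWindow`)

With the stacking theorem `homRelStacks` (`Theorems/DepthWindowHomStacks.lean`) in the tree,
the rank-201 crux `HomSubReach` (item `stmt-ValiantsHypothesis-23791`, split child of
`PerHardLog3`) of route `DepthWindow` is implied BY NAME by any single relative block lemma
`HomRel kk j` of slope `j / kk ≤ 7/5` (`kk ≥ 1`), in particular by each of the named second-layer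
statements `HomRel 2 2`, `HomRel 3 4`, `HomRel 4 5`, `HomRel 5 7` of
`Theorems/DepthWindowHomRel.lean`.  This file records these kernel reductions against the route
declaration itself (it imports the route file, so the route file cannot link back to it).

Nothing here bears on `VP ≠ VNP` beyond converting the crux into its block lemma; the block
lemmas are OPEN (`HomRel 2 2` is expected to be false — shifted-partials road — while
`HomRel 3 4` / `HomRel 5 7` are undecided).

[cite: LimayeSrinivasanTavenas2025, Lemma 11, Lemma 19, Lemma 20] [cite: BhargavDuttaSaxena2024, Thm. 1.4]
-/

set_option linter.dupNamespace false

namespace Summit.ValiantsHypothesis.ValiantsHypothesis.Theorems.DepthWindow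

open Summit.ValiantsHypothesis.ValiantsHypothesis.Theses.DepthWindow (HomSubReach)

/-- The crux `HomSubReach` is the kernel statement `HomSlope75` (forward direction of
`homSlope75_iff`). [cite: LimayeSrinivasanTavenas2025, Lemma 11] -/
theorem homSubReach_of_homSlope75 (h : HomSlope75) : HomSubReach := homSlope75_iff.mp h

/-- Converse bookkeeping: the crux gives `HomSlope75`. [cite: LimayeSrinivasanTavenas2025, Lemma 11] -/
theorem homSlope75_of_homSubReach (h : HomSubReach) : HomSlope75 := homSlope75_iff.mpr h

/-- **The crux from any admissible block lemma**: `HomRel kk j` with `kk ≥ 1` and `5 j ≤ 7 kk`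
implies `HomSubReach` (stacking `homRelStacks` + `homSlope75_iff`).
[cite: LimayeSrinivasanTavenas2025, Lemma 19, Lemma 20] [cite: BhargavDuttaSaxena2024, Thm. 1.4] -/
theorem homSubReach_of_homRel {kk j : ℕ} (hk : 0 < kk) (hkj : 5 * j ≤ 7 * kk) (h : HomRel kk j) :
    HomSubReach :=
  homSubReach_of_homSlope75 (homSlope75_of_homRel' hk hkj h)

/-- `HomRel 2 2` (slope `1`; the most killable block lemma) alone implies the crux.
[cite: LimayeSrinivasanTavenas2025, Lemma 11] -/
theorem homSubReach_of_homRel_2_2 (h : HomRel 2 2) : HomSubReach :=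
  homSubReach_of_homRel (by decide) (by decide) h

/-- `HomRel 3 4` (slope `4/3`) alone implies the crux. [cite: LimayeSrinivasanTavenas2025, Lemma 11] -/
theorem homSubReach_of_homRel_3_4 (h : HomRel 3 4) : HomSubReach :=
  homSubReach_of_homRel (by decide) (by decide) h

/-- `HomRel 4 5` (slope `5/4`) alone implies the crux. [cite: LimayeSrinivasanTavenas2025, Lemma 11] -/
theorem homSubReach_of_homRel_4_5 (h : HomRel 4 5) : HomSubReach :=
  homSubReach_of_homRel (by decide) (by decide) h

/-- `HomRel 5 7` (slope `7/5`, the weakest admissible named block lemma) alone implies the crux.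
[cite: LimayeSrinivasanTavenas2025, Lemma 11] [cite: BhargavDuttaSaxena2024, Thm. 1.4] -/
theorem homSubReach_of_homRel_5_7 (h : HomRel 5 7) : HomSubReach :=
  homSubReach_of_homRel (by decide) (by decide) h

/-- Disjunctive form: any one of the four named block lemmas implies the crux.
[cite: LimayeSrinivasanTavenas2025, Lemma 11] -/
theorem homSubReach_of_homRel_weakest (h : HomRel 2 2 ∨ HomRel 3 4 ∨ HomRel 4 5 ∨ HomRel 5 7) :
    HomSubReach :=
  homSubReach_of_homSlope75 (homSlope75_of_homRel_weakest homRelStacks h)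

end Summit.ValiantsHypothesis.ValiantsHypothesis.Theorems.DepthWindow
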